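import Summits.BirchSwinnertonDyer.Rank1Residual.Iwasawa.SelmerCardOfLevelZeroControl
import Literature.NumberTheory.EllipticCurves.IwasawaAlgebraStructureProofs
import Literature.NumberTheory.EllipticCurves.IwasawaAlgebraCharIdealProofs
import HarnessLib

/-!
# `λ(X) ≠ 0 ⟹ p ∣ #Sel_{p^∞}(E/K)` under trivial level-`0` local tower kernels
# (team n1011, row T-CTL-EC, seat p06 GEN 9, FILE 1b — the `λ`-currency corollary of FILE 1)

HONEST FRAMING (cell `b2b-bsdres-*`, team n1011, verbatim): prove what is provable now; shrink each
hard class to its core with data; no claim beyond stated classes. Research route; TOOL theorems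
only — no definition, no named fact, nothing booked, no residual-map mark moved, no class closed.

## What

FILE 1 (`Iwasawa/SelmerCardOfLevelZeroControl`) gives `f ∉ Λˣ ⟹ p ∣ #Sel_{p^∞}(E/K)` for a generator
`f` of `char_Λ X(E/K_∞)` (trivial level-`0` local tower kernels, `E(K)[p] = 0`, `Sel_{p^∞}(E/K)`
finite) and its `μ`-form. The congruence-transfer ENDs of the cell (Greenberg–Vatsal) deliver the
Iwasawa invariants `λ`, `μ`; this file adds the `λ`-form through the structure theorem in the tree
(`exists_isPseudoIsomorphism_elementary_holds`, `charIdeal_eq_span_holds`,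
`lambdaInvariant_eq_sum_natDegree_holds`): `λ(M) = Σ e_j · deg f_j` over the distinguished factors of
the characteristic element, so `λ(M) ≠ 0` exhibits a distinguished `f_j` of positive degree dividing
every generator of `char_Λ M`, whose constant term is divisible by `p`.

* `not_isUnit_coe_of_isDistinguishedAt_of_natDegree_pos` — a distinguished polynomial of positive
  degree is not a unit of `Λ`;
* `not_isUnit_of_lambdaInvariant_ne_zero_of_charIdeal_eq_span` — **`λ(M) ≠ 0 ⟹` no generator of
  `char_Λ M` is a unit** (`M` finitely generated torsion);
* `dvd_natCard_selmer_of_lambda_ne_zero_of_no_pTorsion[_of_finset]` — **`λ(X(E/K_∞)) ≠ 0 ⟹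
  p ∣ #Sel_{p^∞}(E/K)`** under FILE 1's hypotheses; `…_of_mu_ne_zero…_of_finset` (FILE 1's μ-form,
  finite-set sockets);
* `lambda_ne_zero_of_transfer_of_subsingleton` — the Greenberg–Vatsal feed: `λ(X₁) + a = λ(X₂) + b`,
  `X₁ = 0`, `b < a` ⟹ `λ(X₂) ≠ 0`.

References: [Washington1997] §13.2 (structure theorem, `λ`, `μ`); [GreenbergLNM1716] §4 Thm. 4.1
(pp. 102–104), §3 Prop. 3.8 (p. 96); cells/n1011/skel/T-CTL-EC.md.
-/

noncomputable section

open scoped Classical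

universe u

namespace Summit.BirchSwinnertonDyer.Rank1Residual.Iwasawa

open Literature.NumberTheory.EllipticCurves NumberField IsDedekindDomain Polynomial

section Algebra

variable {p : ℕ} [hp : Fact p.Prime]

/-- A distinguished polynomial of positive degree over `ℤ_p` is not a unit of `Λ = ℤ_p⟦T⟧`: its
constant term lies in the maximal ideal. [folklore] -/
theorem not_isUnit_coe_of_isDistinguishedAt_of_natDegree_pos {f : ℤ_[p][X]}
    (hf : f.IsDistinguishedAt (IsLocalRing.maximalIdeal ℤ_[p])) (hdeg : 0 < f.natDegree) :
    ¬ IsUnit (f : IwasawaAlgebra p) := by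
  intro hu
  have h0 : f.coeff 0 ∈ IsLocalRing.maximalIdeal ℤ_[p] := hf.mem hdeg
  have hc : IsUnit (PowerSeries.constantCoeff (f : PowerSeries ℤ_[p])) :=
    PowerSeries.isUnit_iff_constantCoeff.mp hu
  rw [Polynomial.constantCoeff_coe] at hc
  exact (IsLocalRing.mem_maximalIdeal _).mp h0 hc

/-- **`λ(M) ≠ 0 ⟹` no generator of `char_Λ M` is a unit** (`M` finitely generated torsion): by the
structure theorem `M ∼ ⊕ Λ/p^{μ_i} ⊕ ⊕ Λ/f_j^{e_j}` with `λ(M) = Σ e_j · deg f_j`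
(`lambdaInvariant_eq_sum_natDegree`), a positive `λ` exhibits a distinguished `f_j` of positive degree
with `e_j ≥ 1` dividing the characteristic element, whose constant term is then divisible by `p`.
[cite: Washington1997, §13.2] -/
theorem not_isUnit_of_lambdaInvariant_ne_zero_of_charIdeal_eq_span
    (M : Type*) [AddCommGroup M] [Module (IwasawaAlgebra p) M] [Module.Finite (IwasawaAlgebra p) M]
    (hM : Module.IsTorsion (IwasawaAlgebra p) M) {g : IwasawaAlgebra p}
    (hg : Module.charIdeal (IwasawaAlgebra p) M = Ideal.span {g}) (hlam : lambdaInvariant p M ≠ 0) :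
    ¬ IsUnit g := by
  intro hgu
  obtain ⟨μs, fs, -, hfs, hψ⟩ := exists_isPseudoIsomorphism_elementary_holds p M hM
  have hfs' : ∀ f ∈ fs, f.1.IsDistinguishedAt (IsLocalRing.maximalIdeal ℤ_[p]) :=
    fun f hf ↦ (hfs f hf).1
  have hchar : Module.charIdeal (IwasawaAlgebra p) M = Ideal.span {charElement p μs fs} :=
    charIdeal_eq_span_holds p M hfs' hψ
  have hlamsum : lambdaInvariant p M = (fs.map fun f => f.2 * f.1.natDegree).sum :=
    lambdaInvariant_eq_sum_natDegree_holds p M hfs' hψ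
  -- the characteristic element is a unit (it generates the same ideal as the unit `g`)
  have htop : Ideal.span {charElement p μs fs} = ⊤ := by
    rw [← hchar, hg, Ideal.span_singleton_eq_top]
    exact hgu
  have hcu : IsUnit (charElement p μs fs) := Ideal.span_singleton_eq_top.mp htop
  -- every factor `f_j^{e_j}` divides it, hence is a unit
  have hprod : IsUnit ((fs.map fun f => (f.1 : IwasawaAlgebra p) ^ f.2).prod) := by
    unfold charElement at hcu
    exact isUnit_of_mul_isUnit_right hcu
  -- so every summand `e_j · deg f_j` vanishes
  apply hlam
  rw [hlamsum]
  refine List.sum_eq_zero fun x hx ↦ ?_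
  obtain ⟨f, hf, rfl⟩ := List.mem_map.mp hx
  have hfu : IsUnit ((f.1 : IwasawaAlgebra p) ^ f.2) :=
    isUnit_of_dvd_unit (List.dvd_prod (List.mem_map.mpr ⟨f, hf, rfl⟩)) hprod
  have hpos : 0 < f.2 := (hfs f hf).2.2
  have hfu' : IsUnit (f.1 : IwasawaAlgebra p) := (isUnit_pow_iff hpos.ne').mp hfu
  by_contra hne
  have hdeg : 0 < f.1.natDegree := by
    rcases Nat.eq_zero_or_pos f.1.natDegree with h | h
    · exact absurd (by rw [h, mul_zero]) hne
    · exact h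
  exact not_isUnit_coe_of_isDistinguishedAt_of_natDegree_pos (hfs' f hf) hdeg hfu'

end Algebra

section Selmer

variable {K : Type u} [Field K] [NumberField K] (W : WeierstrassCurve K) [W.IsElliptic]
  {p : ℕ} [hp : Fact p.Prime] {κ : ZpExtension K p} {γ : Field.absoluteGaloisGroup K}

/-- **`λ(X) ≠ 0 ⟹ p ∣ #Sel_{p^∞}(E/K)`** (`E(K)[p] = 0`, `Sel_{p^∞}(E/K)` finite, trivial level-`0`
local tower kernels at every place): a positive `λ`-invariant of `X(E/K_∞)` makes every generator of
the characteristic ideal a non-unit (`not_isUnit_of_lambdaInvariant_ne_zero_of_charIdeal_eq_span`),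
and FILE 1's `dvd_natCard_selmer_of_not_isUnit_of_no_pTorsion` gives the divisibility.
[cite: GreenbergLNM1716, §4 Thm. 4.1 (proof, pp. 102–104) and §3 Prop. 3.8 (p. 96)] [cite: Washington1997, §13.2] -/
theorem dvd_natCard_selmer_of_lambda_ne_zero_of_no_pTorsion
    (D : W.SelmerDualData κ γ) (hγ : κ.IsTopGenerator γ) (hSel : Finite ↥(W.selmerGroupPInfty p))
    (hK : ∀ P : W.toAffine.Point, p • P = 0 → P = 0) (hlam : D.lambda ≠ 0)
    (h0 : ∀ v : HeightOneSpectrum (𝓞 K), W.localTowerKerPrimary κ (v.adicCompletion K) 0 = ⊥) :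
    p ∣ Nat.card ↥(W.selmerGroupPInfty p) := by
  haveI : (Module.charIdeal (IwasawaAlgebra p) D.X).IsPrincipal := charIdeal_isPrincipal_holds p D.X
  obtain ⟨f, hf⟩ := Submodule.IsPrincipal.principal (Module.charIdeal (IwasawaAlgebra p) D.X)
  have hf' : D.charIdeal = Ideal.span {f} := hf
  obtain ⟨hFG, hX, -, -, -, -⟩ := constantCoeff_mul_natCard_eq_of_no_pTorsion W D hγ hSel hK f hf' h0
  haveI := hFG
  exact dvd_natCard_selmer_of_not_isUnit_of_no_pTorsion W D hγ hSel hK f hf'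
    (not_isUnit_of_lambdaInvariant_ne_zero_of_charIdeal_eq_span D.X hX hf hlam) h0

/-- `λ(X) ≠ 0 ⟹ p ∣ #Sel_{p^∞}(E/K)`, socket hypothesis on a finite `S ⊇ {v ∣ p} ∪ {bad v}`.
[cite: GreenbergLNM1716, §4 Thm. 4.1 (proof, pp. 102–104) and §3 Prop. 3.8 (p. 96)] [cite: Washington1997, §13.2] -/
theorem dvd_natCard_selmer_of_lambda_ne_zero_of_no_pTorsion_of_finset
    (D : W.SelmerDualData κ γ) (hγ : κ.IsTopGenerator γ) (hSel : Finite ↥(W.selmerGroupPInfty p))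
    (hK : ∀ P : W.toAffine.Point, p • P = 0 → P = 0) (hlam : D.lambda ≠ 0)
    (S : Finset (HeightOneSpectrum (𝓞 K)))
    (hS : ∀ v ∈ S, W.localTowerKerPrimary κ (v.adicCompletion K) 0 = ⊥)
    (hgood : ∀ v ∉ S, (p : 𝓞 K) ∉ v.asIdeal ∧ W.HasGoodReductionAt v) :
    p ∣ Nat.card ↥(W.selmerGroupPInfty p) :=
  dvd_natCard_selmer_of_lambda_ne_zero_of_no_pTorsion W D hγ hSel hK hlam
    (localTowerKerPrimary_zero_eq_bot_of_finset W κ S hS hgood)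

/-- `μ(X) ≠ 0 ⟹ p ∣ #Sel_{p^∞}(E/K)`, socket hypothesis on a finite `S ⊇ {v ∣ p} ∪ {bad v}` (the
finite-set form of FILE 1's `dvd_natCard_selmer_of_mu_ne_zero_of_no_pTorsion`).
[cite: GreenbergLNM1716, §4 Thm. 4.1 (proof, pp. 102–104) and §3 Prop. 3.8 (p. 96)] [cite: GreenbergVatsal2000, p. 2, (1)–(2)] -/
theorem dvd_natCard_selmer_of_mu_ne_zero_of_no_pTorsion_of_finset
    (D : W.SelmerDualData κ γ) (hγ : κ.IsTopGenerator γ) (hSel : Finite ↥(W.selmerGroupPInfty p))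
    (hK : ∀ P : W.toAffine.Point, p • P = 0 → P = 0) (hμ : D.mu ≠ 0)
    (S : Finset (HeightOneSpectrum (𝓞 K)))
    (hS : ∀ v ∈ S, W.localTowerKerPrimary κ (v.adicCompletion K) 0 = ⊥)
    (hgood : ∀ v ∉ S, (p : 𝓞 K) ∉ v.asIdeal ∧ W.HasGoodReductionAt v) :
    p ∣ Nat.card ↥(W.selmerGroupPInfty p) :=
  dvd_natCard_selmer_of_mu_ne_zero_of_no_pTorsion W D hγ hSel hK hμ
    (localTowerKerPrimary_zero_eq_bot_of_finset W κ S hS hgood)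

/-- **The Greenberg–Vatsal feed.** If two dual data `D₁` (of `E₁`) and `D₂` (of `E₂`) over the same
`ℤ_p`-extension satisfy a transfer identity `λ(X₁) + a = λ(X₂) + b` (the shape of the cell's
`muLambdaAlg_transfer_of_torsionIso_potOrd_of_not_dvd_torsionOrder[_of_records]`, with `a`, `b` the sums
of local `δ`-invariants over `Σ₀`) and `X₁ = 0` (a trivial partner, T-T3CTL F1), then `b < a` forces
`λ(X₂) ≠ 0`. Pure bookkeeping. [cite: GreenbergVatsal2000, §2 (p. 27, the λ-transfer identity)] -/
theorem lambda_ne_zero_of_transfer_of_subsingleton {W₁ W₂ : WeierstrassCurve K}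
    {κ : ZpExtension K p} {γ : Field.absoluteGaloisGroup K}
    (D₁ : W₁.SelmerDualData κ γ) (D₂ : W₂.SelmerDualData κ γ) [Subsingleton D₁.X] {a b : ℕ}
    (h : lambdaInvariant p D₁.X + a = lambdaInvariant p D₂.X + b) (hba : b < a) :
    D₂.lambda ≠ 0 := by
  have h1 : lambdaInvariant p D₁.X = 0 := lambda_eq_zero_of_subsingleton D₁
  change lambdaInvariant p D₂.X ≠ 0
  omega

end Selmer

end Summit.BirchSwinnertonDyer.Rank1Residual.Iwasawa

end
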